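import Mathlib
import Literature.LinearAlgebra.Matrix.InverseMMatrix
import HarnessLib

/-!
# Positive supersolutions bound symmetric Z-matrices from below (Berman–Plemmons Ch. 6, Ex. 4.14 + Ex. 4.15; Collatz / Barta)

Topic `LinearAlgebra/Matrix`, namespace `Literature.LinearAlgebra.Matrix`; sibling of `InverseMMatrix.lean`
(`IsZMatrix`: off-diagonal entries `≤ 0`) and `StieltjesMatrixProofs.lean`.

**The statement.** Let `A` be a real symmetric Z-matrix and `x` an entrywise positive vector with
`(A x)_i ≥ m · x_i` for every `i` (a *positive supersolution* at level `m`). Then `A - m • 1` is positive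
semidefinite, i.e. `m · ‖v‖² ≤ vᵀ A v` for every `v`; in particular `λ_min(A) ≥ m`.

Source: Berman–Plemmons, *Nonnegative Matrices in the Mathematical Sciences* [BermanPlemmons1994], Ch. 6:
Exercise 4.14 ("if `A ∈ Z^{n×n}` and there exists `x ≫ 0` such that `Ax ≥ 0`, then `A` is an M-matrix")
combined with Exercise 4.15 ("let `A ∈ Z^{n×n}` be symmetric; then `A` is an M-matrix if and only if `A` is
positive semidefinite"), applied to the Z-matrix `A - mI`; locators checked in the held 1979 edition
(`book:berman1979-nonnegative-matrices-mathematical-sciences`, PDF p. 120). The inequality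
`λ_min(A) ≥ min_i (Ax)_i / x_i` for `x ≫ 0` is the Collatz–Wielandt / Barta bound for the "stoquastic" sign
structure.

**The proof given here** is the direct ground-state-transformation identity, which needs no
Perron–Frobenius theory: with `B = A - m • 1` (again a symmetric Z-matrix, now with `B x ≥ 0`) and
`u_i = x_i φ_i`,
`uᵀ B u = Σ_i x_i φ_i² (B x)_i − ½ Σ_{i,j} B_ij x_i x_j (φ_i − φ_j)² ≥ 0`,
both terms being nonnegative (`B_ij ≤ 0` off the diagonal, the diagonal terms of the second sum vanish).

**Use.** This is the soundness lemma of exact "supersolution certificates" for lower eigenvalue bounds of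
large sparse symmetric Z-matrices (e.g. particle-number blocks of nearest-neighbour fermion chains in a
spin-major Jordan–Wigner basis, bipartite antiferromagnets after the Marshall sign change): checking
`(A - m) X ≥ 0` for ONE positive integer vector `X` in exact arithmetic certifies `A ⪰ m`, with no
factorisation. Deliberately NOT here: irreducibility / Perron–Frobenius refinements (equality cases), the
non-symmetric M-matrix theory (`InverseMMatrix.lean`, `StieltjesMatrix.lean` cover what is needed elsewhere).
-/

namespace Literature.LinearAlgebra.Matrix

open scoped _root_.Matrix
open Finset _root_.Matrix

variable {ι : Type*} [Fintype ι]

/-- `u ⬝ᵥ (B *ᵥ u)` written as a double sum `Σ_i Σ_j B_ij u_i u_j` (private plumbing). [folklore] -/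
private theorem dotProduct_mulVec_eq_sum_sum (B : Matrix ι ι ℝ) (u : ι → ℝ) :
    u ⬝ᵥ (B *ᵥ u) = ∑ i, ∑ j, B i j * u i * u j := by
  simp only [dotProduct, Matrix.mulVec, Finset.mul_sum]
  refine Finset.sum_congr rfl fun i _ => Finset.sum_congr rfl fun j _ => ?_
  ring

/-- **Ground-state-transformation inequality.** For a symmetric Z-matrix `B` and an entrywise positive
`x` with `B x ≥ 0` entrywise, the quadratic form of `B` is nonnegative: with `u_i = x_i φ_i`,
`Σ_ij B_ij u_i u_j = Σ_i x_i φ_i² (Bx)_i − ½ Σ_ij B_ij x_i x_j (φ_i − φ_j)² ≥ 0`.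
[cite: BermanPlemmons1994, Ch. 6, Exercise 4.14 and Exercise 4.15] -/
theorem IsZMatrix.sum_sum_mul_mul_nonneg_of_supersolution {B : Matrix ι ι ℝ} (hB : B.IsSymm)
    (hZ : IsZMatrix B) (x : ι → ℝ) (hx : ∀ i, 0 < x i)
    (hsup : ∀ i, 0 ≤ (B *ᵥ x) i) (u : ι → ℝ) :
    0 ≤ ∑ i, ∑ j, B i j * u i * u j := by
  classical
  set φ : ι → ℝ := fun i => u i / x i with hφ
  have hu : ∀ i, u i = x i * φ i := fun i => by
    simp only [hφ]
    field_simp [(hx i).ne']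
  have key : ∀ i j, B i j * u i * u j =
      x i * φ i ^ 2 * (B i j * x j) - (1 / 2) * (B i j * x i * x j * (φ i - φ j) ^ 2)
        - (1 / 2) * (B i j * x i * x j * φ i ^ 2 - B i j * x i * x j * φ j ^ 2) := by
    intro i j
    rw [hu i, hu j]
    ring
  simp_rw [key, Finset.sum_sub_distrib, ← Finset.mul_sum]
  -- the antisymmetric part vanishes (symmetry of `B`)
  have hanti : ∑ i, ∑ j, (B i j * x i * x j * φ i ^ 2 - B i j * x i * x j * φ j ^ 2) = 0 := by
    have hsym : ∑ i, ∑ j, B i j * x i * x j * φ j ^ 2 = ∑ i, ∑ j, B i j * x i * x j * φ i ^ 2 := by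
      rw [Finset.sum_comm]
      refine Finset.sum_congr rfl fun a _ => Finset.sum_congr rfl fun b _ => ?_
      rw [hB.apply a b]
      ring
    simp_rw [Finset.sum_sub_distrib]
    rw [hsym, sub_self]
  -- the supersolution part is nonnegative
  have hT1 : 0 ≤ ∑ i, x i * φ i ^ 2 * ∑ j, B i j * x j := by
    refine Finset.sum_nonneg fun i _ => ?_
    have h1 : 0 ≤ x i * φ i ^ 2 := mul_nonneg (hx i).le (sq_nonneg _)
    have h2 : 0 ≤ ∑ j, B i j * x j := by
      have := hsup i
      simpa [Matrix.mulVec, dotProduct] using this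
    exact mul_nonneg h1 h2
  -- the Dirichlet part is nonpositive termwise
  have hT2 : ∑ i, ∑ j, B i j * x i * x j * (φ i - φ j) ^ 2 ≤ 0 := by
    refine Finset.sum_nonpos fun i _ => Finset.sum_nonpos fun j _ => ?_
    by_cases hij : i = j
    · subst hij; simp
    · have h1 : B i j * x i * x j ≤ 0 :=
        mul_nonpos_of_nonpos_of_nonneg (mul_nonpos_of_nonpos_of_nonneg (hZ i j hij) (hx i).le) (hx j).le
      exact mul_nonpos_of_nonpos_of_nonneg h1 (sq_nonneg _)
  linarith [hT1, hT2, hanti]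

variable [DecidableEq ι]

/-- **Positive supersolutions bound symmetric Z-matrices from below** (Berman–Plemmons Ch. 6,
Ex. 4.14: a Z-matrix with `x ≫ 0`, `Ax ≥ 0` is an M-matrix; Ex. 4.15: a symmetric Z-matrix is an
M-matrix iff it is positive semidefinite — applied to `A - mI`). If `A` is a real symmetric Z-matrix and
`x` is entrywise positive with `m * x i ≤ (A x) i` for every `i`, then `A - m • 1 ⪰ 0`.
[cite: BermanPlemmons1994, Ch. 6, Exercise 4.14 and Exercise 4.15] -/
theorem IsZMatrix.posSemidef_sub_smul_one_of_supersolution {A : Matrix ι ι ℝ} (hA : A.IsSymm)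
    (hZ : IsZMatrix A) (x : ι → ℝ) (hx : ∀ i, 0 < x i) (m : ℝ)
    (hsup : ∀ i, m * x i ≤ (A *ᵥ x) i) :
    (A - m • (1 : Matrix ι ι ℝ)).PosSemidef := by
  set B : Matrix ι ι ℝ := A - m • (1 : Matrix ι ι ℝ) with hBdef
  have hBsymm : B.IsSymm := by
    unfold Matrix.IsSymm
    rw [hBdef, Matrix.transpose_sub, Matrix.transpose_smul, Matrix.transpose_one, hA.eq]
  have hBoff : IsZMatrix B := by
    intro i j hij
    simp [hBdef, Matrix.sub_apply, Matrix.smul_apply, Matrix.one_apply_ne hij, hZ i j hij]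
  have hBsup : ∀ i, 0 ≤ (B *ᵥ x) i := by
    intro i
    have h := hsup i
    rw [hBdef, Matrix.sub_mulVec, Matrix.smul_mulVec, Matrix.one_mulVec, Pi.sub_apply,
      Pi.smul_apply, smul_eq_mul]
    linarith
  refine Matrix.PosSemidef.of_dotProduct_mulVec_nonneg ?_ ?_
  · exact (Matrix.isHermitian_iff_isSymm).mpr hBsymm
  · intro u
    rw [star_trivial, dotProduct_mulVec_eq_sum_sum]
    exact hBoff.sum_sum_mul_mul_nonneg_of_supersolution hBsymm x hx hBsup u

/-- Rayleigh-quotient form of the supersolution bound: under the hypotheses of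
`IsZMatrix.posSemidef_sub_smul_one_of_supersolution`, `m * ‖v‖² ≤ vᵀ A v` for every `v`
(so every eigenvalue of `A` is `≥ m`; with `m = min_i (Ax)_i / x_i` this is the Collatz–Wielandt /
Barta lower bound). [cite: BermanPlemmons1994, Ch. 6, Exercise 4.14 and Exercise 4.15] -/
theorem IsZMatrix.le_dotProduct_mulVec_of_supersolution {A : Matrix ι ι ℝ} (hA : A.IsSymm)
    (hZ : IsZMatrix A) (x : ι → ℝ) (hx : ∀ i, 0 < x i) (m : ℝ)
    (hsup : ∀ i, m * x i ≤ (A *ᵥ x) i) (v : ι → ℝ) :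
    m * (v ⬝ᵥ v) ≤ v ⬝ᵥ (A *ᵥ v) := by
  have h := (hZ.posSemidef_sub_smul_one_of_supersolution hA x hx m hsup).dotProduct_mulVec_nonneg v
  rw [star_trivial, Matrix.sub_mulVec, Matrix.smul_mulVec, Matrix.one_mulVec, dotProduct_sub,
    dotProduct_smul, smul_eq_mul] at h
  linarith

end Literature.LinearAlgebra.Matrix
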